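import Literature.Barriers.NavierStokesRegularity.NavierStokesInequalityStructureCompactness
import HarnessLib

/-!
# The margin `L(√(f² - εφ)) > 0` away from `{φ = 1}` (Ożański 2017, Lemma 4.1; Scheffer (3.15))

Barrier catalogue support file for `NavierStokesRegularity` (D-0021), on the discharge path of
fact D-II `Literature.Barriers.NavierStokesRegularity.NSIProfiles_of_arrangement`
(`NavierStokesInequalityProfiles`; W. S. Ożański, arXiv:1709.00602v4, §4, Lemma 4.1 and
(4.16); V. Scheffer, Comm. Math. Phys. 101 (1985), Lemma 3.1 (3.15): "`L(hᵢ,ₜ) ≥ 0` where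
`gᵢ < 1`"). The time-dependent profiles of Lemma 4.1 are `hᵢ,ₜ = √(fᵢ² - 2tδφᵢ)` off
`{φᵢ = 1}` (there `vᵢ = 0`, so the interaction integrals of (4.14), (4.16) vanish and
`qᵏᵢ,ₜ = hᵢ,ₜ` as well), and the profile data of the tree (`IsNSIProfileData.opL₁/₂`) ask for
`Q L(Q) ≥ 0` off the closed set `Cᵢ = {φᵢ ≥ θ}`, `θ < 1`. The print obtains `L hᵢ,ₜ > 0` on
`Uᵢ ∖ {φᵢ = 1}` "immediately" from `(vᵢ, hᵢ,ₜ, φᵢ)` being a structure; what is actually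
available is a MARGIN by compactness (cf. the module docstring of
`NavierStokesInequalityStructureCompactness`): on the compact `K = supp φ ∩ {φ ≤ θ} ⊆ U ∖ {φ = 1}`
one has `Lf ≥ c₀ > 0` (`exists_opL_ge_of_lt_one`) and `f ≥ c > 0`, so `(ε, q) ↦ √(f(q)² - εφ(q))`
is jointly smooth near `[0, c²/2] × K`, its planar derivatives up to order two are jointly
(uniformly) continuous there, and `L` — a linear second-order operator — of the slice at `ε`
is within `c₀/2` of `Lf` for `ε` small. This file PROVES, for a structure `(v,f,φ)` on `U`:

* `opL_congr_of_eventuallyEq` — locality of `L`;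
* `exists_opL_sqrt_ge` — **for every `θ < 1` there are `c₀, ε₀ > 0` with
  `L(√(f² - εφ))(q) ≥ c₀` for all `ε ∈ [0, ε₀]`, `q ∈ supp φ`, `φ(q) ≤ θ`**;
* `exists_sqrt_mul_opL_sqrt_nonneg` — hence **`Q L(Q) ≥ 0` on `P ∖ {φ > θ}`** for
  `Q = √(f² - εφ)`, `ε ∈ [0, ε₀]` (off `supp φ`, `Q = f` near the point and `f Lf ≥ 0` on `P`
  by Definition 3.3 and continuity, `opL_nonneg_of_mem_closure`);
* `exists_sqrt_sq_gap` — **`f² - εφ - |v|² ≥ m > 0` on `supp φ`** for `ε ∈ [0, ε₀]`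
  (Ożański: "`δ < min_{supp φ₁}|f₁² - |v₁|²|/2(T+2)` to obtain `h₁,ₜ > |v₁|` in `supp φ₁`").

With `ε = 2tδ`, `t ∈ [0,T]`, these are the `L`- and positivity margins of Lemma 4.1 for `h₁,ₜ`
(and for `h₂,ₜ`, `qᵏᵢ,ₜ` off `{φᵢ = 1}`), uniformly in `t`, for `δ ≤ ε₀/(2T)`.

## Mathlib search

`hasFDerivAt_prodMk_right`, `ContDiffOn.fderiv_of_isOpen`, `ContDiffOn.continuousOn`,
`IsCompact.uniformContinuousOn_of_continuous`, `Metric.uniformContinuousOn_iff`,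
`ContDiffAt.sqrt`, `Filter.EventuallyEq.fderiv_eq` (used).

## References

* W. S. Ożański, arXiv:1709.00602v4, §4, Lemma 4.1 and its proof, (4.13)–(4.16).
  [`Ozanski2017NSISingular`] (Held plain-text rendering: Lemma 8.)
* V. Scheffer, Comm. Math. Phys. 101 (1985), Lemma 3.1, (3.11) and (3.15). [`Scheffer1985`]
-/

noncomputable section

open Set Function Filter Topology TopologicalSpace Metric
open scoped ContDiff

namespace Literature.Barriers.NavierStokesRegularity

open Literature.Analysis.FluidPDE

/-! ### Locality of `L` -/

/-- `∂ᵣ` is local. [folklore] -/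
theorem derivR_congr_of_eventuallyEq {g₁ g₂ : ℝ × ℝ → ℝ} {q : ℝ × ℝ} (h : g₁ =ᶠ[𝓝 q] g₂) :
    derivR g₁ =ᶠ[𝓝 q] derivR g₂ := by
  filter_upwards [h.eventuallyEq_nhds] with q' hq'
  rw [derivR, derivR, hq'.fderiv_eq]

/-- `∂_z` is local. [folklore] -/
theorem derivZ_congr_of_eventuallyEq {g₁ g₂ : ℝ × ℝ → ℝ} {q : ℝ × ℝ} (h : g₁ =ᶠ[𝓝 q] g₂) :
    derivZ g₁ =ᶠ[𝓝 q] derivZ g₂ := by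
  filter_upwards [h.eventuallyEq_nhds] with q' hq'
  rw [derivZ, derivZ, hq'.fderiv_eq]

/-- **`L` is a local operator**: `g₁ = g₂` near `q` implies `Lg₁(q) = Lg₂(q)`. [folklore] -/
theorem opL_congr_of_eventuallyEq {g₁ g₂ : ℝ × ℝ → ℝ} {q : ℝ × ℝ} (h : g₁ =ᶠ[𝓝 q] g₂) :
    opL g₁ q = opL g₂ q := by
  simp only [opL]
  rw [derivR, (derivR_congr_of_eventuallyEq h).fderiv_eq, derivZ,
    (derivZ_congr_of_eventuallyEq h).fderiv_eq, (derivR_congr_of_eventuallyEq h).self_of_nhds,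
    h.self_of_nhds]
  rfl

/-! ### Slice derivatives of a jointly differentiable planar family -/

/-- The derivative of a slice `q ↦ Φ(ε, q)` of a family differentiable at `(ε, q)` is the partial
derivative: `D(Φ(ε,·))(q) w = DΦ(ε,q)(0,w)`. [folklore] -/
theorem fderiv_slice_apply {Φ : ℝ × (ℝ × ℝ) → ℝ} {ε : ℝ} {q : ℝ × ℝ}
    (hΦ : DifferentiableAt ℝ Φ (ε, q)) (w : ℝ × ℝ) :
    fderiv ℝ (fun q' => Φ (ε, q')) q w = fderiv ℝ Φ (ε, q) (0, w) := by
  have h : HasFDerivAt (fun q' => Φ (ε, q'))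
      ((fderiv ℝ Φ (ε, q)).comp (ContinuousLinearMap.inr ℝ ℝ (ℝ × ℝ))) q :=
    hΦ.hasFDerivAt.comp q (hasFDerivAt_prodMk_right (𝕜 := ℝ) ε q)
  rw [h.fderiv]
  simp

/-- **`L` of a slice in terms of joint partial derivatives.** If `Φ` is `C²` on an open set
`O ∋ (ε, q)`, then `L(Φ(ε,·))(q) = D(∂ᵣΦ)(ε,q)(0,(1,0)) + D(∂_zΦ)(ε,q)(0,(0,1)) +
r⁻¹ ∂ᵣΦ(ε,q) - Φ(ε,q)/r²` with the JOINT partials `∂ᵣΦ = DΦ(·)(0,(1,0))`,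
`∂_zΦ = DΦ(·)(0,(0,1))`. [folklore] -/
theorem opL_slice_eq {Φ : ℝ × (ℝ × ℝ) → ℝ} {O : Set (ℝ × (ℝ × ℝ))} (hO : IsOpen O)
    (hΦ : ContDiffOn ℝ 2 Φ O) {ε : ℝ} {q : ℝ × ℝ} (hq : (ε, q) ∈ O) :
    opL (fun q' => Φ (ε, q')) q =
      fderiv ℝ (fun p => fderiv ℝ Φ p (0, (1, 0))) (ε, q) (0, (1, 0)) +
        fderiv ℝ (fun p => fderiv ℝ Φ p (0, (0, 1))) (ε, q) (0, (0, 1)) +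
        (q.1)⁻¹ * fderiv ℝ Φ (ε, q) (0, (1, 0)) - Φ (ε, q) / q.1 ^ 2 := by
  have hD : ContDiffOn ℝ 1 (fderiv ℝ Φ) O := hΦ.fderiv_of_isOpen hO (by norm_num)
  have hdiff : ∀ p ∈ O, DifferentiableAt ℝ Φ p := fun p hp =>
    (hΦ.differentiableOn (by norm_num) p hp).differentiableAt (hO.mem_nhds hp)
  have hGdiff : ∀ w : ℝ × ℝ, DifferentiableAt ℝ (fun p => fderiv ℝ Φ p (0, w)) (ε, q) := fun w =>
    (((hD.clm_apply contDiffOn_const).differentiableOn one_ne_zero) _ hq).differentiableAt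
      (hO.mem_nhds hq)
  -- the slice `{q' | (ε, q') ∈ O}` is an open neighbourhood of `q`
  have hOq : {q' : ℝ × ℝ | (ε, q') ∈ O} ∈ 𝓝 q :=
    (hO.preimage (Continuous.prodMk_right ε)).mem_nhds hq
  have hR : derivR (fun q' => Φ (ε, q')) =ᶠ[𝓝 q] fun q' => fderiv ℝ Φ (ε, q') (0, (1, 0)) := by
    filter_upwards [hOq] with q' hq'
    exact fderiv_slice_apply (hdiff _ hq') _
  have hZ : derivZ (fun q' => Φ (ε, q')) =ᶠ[𝓝 q] fun q' => fderiv ℝ Φ (ε, q') (0, (0, 1)) := by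
    filter_upwards [hOq] with q' hq'
    exact fderiv_slice_apply (hdiff _ hq') _
  simp only [opL]
  rw [derivR, hR.fderiv_eq, fderiv_slice_apply (Φ := fun p => fderiv ℝ Φ p (0, (1, 0))) (hGdiff _),
    derivZ, hZ.fderiv_eq, fderiv_slice_apply (Φ := fun p => fderiv ℝ Φ p (0, (0, 1))) (hGdiff _),
    hR.self_of_nhds]

/-- The right-hand side of `opL_slice_eq` is continuous on `O ∩ {r ≠ 0}` for `Φ ∈ C²(O)`.
[folklore] -/
theorem continuousOn_opL_slice {Φ : ℝ × (ℝ × ℝ) → ℝ} {O : Set (ℝ × (ℝ × ℝ))} (hO : IsOpen O)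
    (hΦ : ContDiffOn ℝ 2 Φ O) :
    ContinuousOn (fun p : ℝ × (ℝ × ℝ) =>
      fderiv ℝ (fun p => fderiv ℝ Φ p (0, (1, 0))) p (0, (1, 0)) +
        fderiv ℝ (fun p => fderiv ℝ Φ p (0, (0, 1))) p (0, (0, 1)) +
        (p.2.1)⁻¹ * fderiv ℝ Φ p (0, (1, 0)) - Φ p / p.2.1 ^ 2) (O ∩ {p | p.2.1 ≠ 0}) := by
  have hD : ContDiffOn ℝ 1 (fderiv ℝ Φ) O := hΦ.fderiv_of_isOpen hO (by norm_num)
  have hG : ∀ w : ℝ × ℝ, ContDiffOn ℝ 1 (fun p => fderiv ℝ Φ p (0, w)) O := fun w =>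
    hD.clm_apply contDiffOn_const
  have hDG : ∀ (w : ℝ × ℝ) (w' : ℝ × (ℝ × ℝ)),
      ContinuousOn (fun p => fderiv ℝ (fun p => fderiv ℝ Φ p (0, w)) p w') O := fun w w' =>
    (((hG w).fderiv_of_isOpen (m := 0) hO (by norm_num)).clm_apply contDiffOn_const).continuousOn
  have hr : ContinuousOn (fun p : ℝ × (ℝ × ℝ) => (p.2.1)⁻¹) (O ∩ {p | p.2.1 ≠ 0}) :=
    (continuous_fst.comp continuous_snd).continuousOn.inv₀ fun p hp => hp.2
  refine ((((hDG _ _).mono inter_subset_left).add ((hDG _ _).mono inter_subset_left)).add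
    (hr.mul ((hG _).continuousOn.mono inter_subset_left))).sub ?_
  refine (hΦ.continuousOn.mono inter_subset_left).div
    ((continuous_fst.comp continuous_snd).continuousOn.pow 2) fun p hp => pow_ne_zero 2 hp.2

/-! ### The margins for `√(f² - εφ)` -/

namespace IsNSIStructure

variable {U : Set (ℝ × ℝ)} {v : ℝ × ℝ → ℝ × ℝ} {f φ : ℝ × ℝ → ℝ}

/-- **The positivity gap persists: `f² - εφ - |v|² ≥ m > 0` on `supp φ` for `ε ∈ [0, ε₀]`**
(Ożański, proof of Lemma 4.1: `δ < min_{supp φ₁}|f₁² - |v₁|²|/2(T+2)` gives `h₁,ₜ > |v₁|` in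
`supp φ₁`). [cite: Ozanski2017NSISingular, Lemma 4.1 (proof)] -/
theorem exists_sqrt_sq_gap (h : IsNSIStructure U v f φ) :
    ∃ m > 0, ∃ ε₀ > 0, ∀ ε ∈ Icc (0 : ℝ) ε₀, ∀ q ∈ tsupport φ,
      (v q).1 ^ 2 + (v q).2 ^ 2 + m ≤ f q ^ 2 - ε * φ q := by
  obtain ⟨m, hm, hgap⟩ := h.exists_sq_gap
  refine ⟨m / 2, by positivity, m / 2, by positivity, fun ε hε q hq => ?_⟩
  have h1 := hgap q hq
  have hφ := h.φ_mem q
  have h2 : ε * φ q ≤ m / 2 := by nlinarith [hε.1, hε.2, hφ.1, hφ.2]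
  linarith

/-- Off `supp φ` the profile `√(f² - εφ)` is `f` near the point. [folklore] -/
theorem sqrt_sq_sub_eventuallyEq (h : IsNSIStructure U v f φ) {q : ℝ × ℝ} (hq : q ∉ tsupport φ)
    (ε : ℝ) : (fun q' => Real.sqrt (f q' ^ 2 - ε * φ q')) =ᶠ[𝓝 q] f := by
  filter_upwards [(isClosed_tsupport φ).isOpen_compl.mem_nhds hq] with q' hq'
  rw [image_eq_zero_of_notMem_tsupport hq', mul_zero, sub_zero, Real.sqrt_sq (h.f_nonneg q')]

/-- At `ε = 0` the profile `√(f² - εφ)` is `f`. [folklore] -/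
theorem sqrt_sq_sub_zero (h : IsNSIStructure U v f φ) :
    (fun q' => Real.sqrt (f q' ^ 2 - 0 * φ q')) = f := by
  funext q'
  rw [zero_mul, sub_zero, Real.sqrt_sq (h.f_nonneg q')]

/-- **The `L`-margin (Ożański Lemma 4.1; Scheffer (3.15)).** For a structure `(v,f,φ)` on `U` and
a threshold `θ < 1` there are `c₀ > 0` and `ε₀ > 0` such that
`L(√(f² - εφ))(q) ≥ c₀` for all `ε ∈ [0, ε₀]` and all `q ∈ supp φ` with `φ(q) ≤ θ`.
Proof: on the compact `K = supp φ ∩ {φ ≤ θ}`, `f ≥ c > 0` and `Lf ≥ 2c₀ > 0`; the family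
`Φ(ε,q) = √(f(q)² - εφ(q))` is `C^∞` on the open set `{f² - εφ > 0} ⊇ [0, c²/2] × K`, so by
`opL_slice_eq` and uniform continuity of the joint second partials on the compact
`[0, c²/2] × K`, `|L(Φ(ε,·))(q) - Lf(q)| ≤ c₀` for `ε` small (`Φ(0,·) = f`).
[cite: Ozanski2017NSISingular, Lemma 4.1] [cite: Scheffer1985, Lemma 3.1 (3.15)] -/
theorem exists_opL_sqrt_ge (h : IsNSIStructure U v f φ) {θ : ℝ} (hθ : θ < 1) :
    ∃ c₀ > 0, ∃ ε₀ > 0, ∀ ε ∈ Icc (0 : ℝ) ε₀, ∀ q ∈ tsupport φ, φ q ≤ θ →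
      c₀ ≤ opL (fun q' => Real.sqrt (f q' ^ 2 - ε * φ q')) q := by
  obtain ⟨c₁, hc₁, hL⟩ := h.exists_opL_ge_of_lt_one hθ
  obtain ⟨c, hc, hfc⟩ := h.exists_le_f_of_mem_tsupport_φ
  obtain ⟨r₀, hr₀, hr⟩ := h.exists_axis_margin
  -- the family and its domain of smoothness
  set Φ : ℝ × (ℝ × ℝ) → ℝ := fun p => Real.sqrt (f p.2 ^ 2 - p.1 * φ p.2) with hΦ
  set O : Set (ℝ × (ℝ × ℝ)) := {p | 0 < f p.2 ^ 2 - p.1 * φ p.2} with hO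
  have hrad : ContDiff ℝ ∞ fun p : ℝ × (ℝ × ℝ) => f p.2 ^ 2 - p.1 * φ p.2 :=
    ((h.f_smooth.comp contDiff_snd).pow 2).sub (contDiff_fst.mul (h.φ_smooth.comp contDiff_snd))
  have hOo : IsOpen O := isOpen_lt continuous_const hrad.continuous
  have hΦO : ContDiffOn ℝ 2 Φ O := fun p hp =>
    ((hrad.of_le (by norm_cast)).contDiffAt.sqrt (ne_of_gt hp)).contDiffWithinAt
  -- the compact set `[0, c²/2] × K`
  set K : Set (ℝ × ℝ) := tsupport φ ∩ {q | φ q ≤ θ} with hK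
  have hKc : IsCompact K := h.isCompact_tsupport_φ_inter_le θ
  set ε₁ : ℝ := c ^ 2 / 2 with hε₁
  have hε₁pos : 0 < ε₁ := by positivity
  set S : Set (ℝ × (ℝ × ℝ)) := Icc (0 : ℝ) ε₁ ×ˢ K with hS
  have hSc : IsCompact S := (isCompact_Icc).prod hKc
  have hSO : S ⊆ O ∩ {p | p.2.1 ≠ 0} := by
    rintro ⟨ε, q⟩ ⟨hε, hq⟩
    have hf := hfc q hq.1
    have hφ := h.φ_mem q
    refine ⟨?_, ?_⟩
    · change 0 < f q ^ 2 - ε * φ q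
      have h1 : c ^ 2 ≤ f q ^ 2 := pow_le_pow_left₀ hc.le hf 2
      have h2 : ε * φ q ≤ c ^ 2 / 2 := by nlinarith [hε.1, hε.2, hφ.1, hφ.2]
      nlinarith
    · exact ne_of_gt (lt_of_lt_of_le hr₀ (hr q (h.tsupport_φ.trans subset_closure hq.1)))
  -- the continuous function computing `L` of the slices, uniformly continuous on `S`
  set Ψ : ℝ × (ℝ × ℝ) → ℝ := fun p =>
    fderiv ℝ (fun p => fderiv ℝ Φ p (0, (1, 0))) p (0, (1, 0)) +
      fderiv ℝ (fun p => fderiv ℝ Φ p (0, (0, 1))) p (0, (0, 1)) +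
      (p.2.1)⁻¹ * fderiv ℝ Φ p (0, (1, 0)) - Φ p / p.2.1 ^ 2 with hΨ
  have hΨc : ContinuousOn Ψ S := (continuousOn_opL_slice hOo hΦO).mono hSO
  have hΨu := hSc.uniformContinuousOn_of_continuous hΨc
  rw [Metric.uniformContinuousOn_iff] at hΨu
  obtain ⟨ρ, hρ, hρΨ⟩ := hΨu (c₁ / 2) (half_pos hc₁)
  -- `L` of the slice at `ε` is `Ψ (ε, q)`; at `ε = 0` it is `Lf q`
  have hLΨ : ∀ ε q, (ε, q) ∈ S →
      opL (fun q' => Real.sqrt (f q' ^ 2 - ε * φ q')) q = Ψ (ε, q) := fun ε q hp =>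
    opL_slice_eq hOo hΦO (hSO hp).1
  have hL0 : ∀ q ∈ K, opL f q = Ψ (0, q) := fun q hq => by
    rw [← h.sqrt_sq_sub_zero]
    exact hLΨ 0 q ⟨⟨le_rfl, hε₁pos.le⟩, hq⟩
  refine ⟨c₁ / 2, half_pos hc₁, min ε₁ (ρ / 2), lt_min hε₁pos (by positivity),
    fun ε hε q hq hφq => ?_⟩
  have hqK : q ∈ K := ⟨hq, hφq⟩
  have hεS : (ε, q) ∈ S := ⟨⟨hε.1, hε.2.trans (min_le_left _ _)⟩, hqK⟩
  have h0S : ((0 : ℝ), q) ∈ S := ⟨⟨le_rfl, hε₁pos.le⟩, hqK⟩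
  have hdist : dist (ε, q) ((0 : ℝ), q) < ρ := by
    rw [Prod.dist_eq, dist_self, max_eq_left dist_nonneg, Real.dist_eq, sub_zero,
      abs_of_nonneg hε.1]
    exact lt_of_le_of_lt (hε.2.trans (min_le_right _ _)) (by linarith)
  have hclose := hρΨ _ hεS _ h0S hdist
  rw [Real.dist_eq] at hclose
  rw [hLΨ ε q hεS]
  have h1 := hL q hq hφq
  rw [hL0 q hqK] at h1
  have := abs_lt.1 hclose
  linarith

/-- **`Q L(Q) ≥ 0` on `P ∖ {φ > θ}` for `Q = √(f² - εφ)`, `ε ∈ [0, ε₀]`** — the form used by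
the tree's profile data (`IsNSIProfileData.opL₁/₂` off `Cᵢ = {φᵢ ≥ θ'}`, any `θ' ≤ θ`): on
`supp φ` by `exists_opL_sqrt_ge`; off `supp φ`, `Q = f` near the point (`opL_congr_of_eventuallyEq`)
and `f Lf ≥ 0` on the open half-plane (`Lf ≥ 0` on `Ū ∖ {φ = 1}`, `f = 0` off `Ū`).
[cite: Ozanski2017NSISingular, Lemma 4.1 and Definition 3.3]
[cite: Scheffer1985, Lemma 3.1 (3.15)] -/
theorem exists_sqrt_mul_opL_sqrt_nonneg (h : IsNSIStructure U v f φ) {θ : ℝ} (hθ : θ < 1) :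
    ∃ ε₀ > 0, ∀ ε ∈ Icc (0 : ℝ) ε₀, ∀ q : ℝ × ℝ, φ q ≤ θ → 0 < q.1 →
      0 ≤ Real.sqrt (f q ^ 2 - ε * φ q) *
        opL (fun q' => Real.sqrt (f q' ^ 2 - ε * φ q')) q := by
  obtain ⟨c₀, hc₀, ε₀, hε₀, hL⟩ := h.exists_opL_sqrt_ge hθ
  refine ⟨ε₀, hε₀, fun ε hε q hφq _ => ?_⟩
  by_cases hq : q ∈ tsupport φ
  · exact mul_nonneg (Real.sqrt_nonneg _) (hc₀.le.trans (hL ε hε q hq hφq))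
  · have hfq : Real.sqrt (f q ^ 2 - ε * φ q) = f q :=
      (h.sqrt_sq_sub_eventuallyEq hq ε).self_of_nhds
    rw [opL_congr_of_eventuallyEq (h.sqrt_sq_sub_eventuallyEq hq ε), hfq]
    by_cases hqU : q ∈ closure U
    · have hφ1 : φ q ≠ 1 := by
        rw [image_eq_zero_of_notMem_tsupport hq]; exact zero_ne_one
      exact mul_nonneg (h.f_nonneg q) (h.opL_nonneg_of_mem_closure hqU hφ1)
    · rw [h.f_eq_zero hqU, zero_mul]

end IsNSIStructure

end Literature.Barriers.NavierStokesRegularity
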